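import Summits.CriticalPhenomena.PercolationContinuityZ3.Theorems.PercNearOneGluingNoHeavyQuantSGCLightPairPairTools
import HarnessLib

/-!
# QUANT lane R8, T-DEC, leg (III): cell PP of `SingleGateConvClosed` REDUCED TO REAL ALGEBRA — the explicit five-atom law
# `gate_q({lo₁, hi₁; γ₁} ∗ {lo₂, hi₂; γ₂})`, its self-sufficiency, DEC(j′) from the one-low capacity inequality, and the first regime

builds on p205010 (kernel theorem, internal audit signed; external expert review pending)

Support file (`--supports stmt-CriticalPhenomena-4575`), QUANT lane, TYPER seat prim-quant-stmt (gen 31), rung R8 of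
`run/shared/lean/prim/quant/LADDER.md`; companion of `…QuantSGCLightPairPairTools` (`lightPair_two_lo_ge`, `lightPair_lo_pos`,
`decAt_of_zeroCapacity`) and `…QuantSGCLightCellsBoth` (the cell `SGCLightPairPair`).  Theorems only, standard axioms, no sorries.

* `LawDec.shift_TP_apply`, **`LawDec.gate_lconv_TP_TP_apply`**, `LawDec.gate_lconv_TP_TP_laws` — the law `P = gate_q({lo₁, hi₁; γ₁} ∗ {lo₂, hi₂; γ₂})`
  explicitly: `P = (1−q)δ₀ + q[(1−γ₂)·{lo₁+lo₂, hi₁+lo₂; γ₁} + γ₂·{lo₁+hi₂, hi₁+hi₂; γ₁}]`, a probability law on `{0..M₁+M₂}` of mean `q(T₁+T₂)`.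
* **`LawDec.sgcLightPairPair_selfSufficient`** — under PP's hypotheses every charged atom `k > 0` of `P` has `q(T₁+T₂) ≤ 2k`: the gate zero is
  the ONLY low atom of `P` at every layer (`lightPair_two_lo_ge` on each factor).
* **`LawDec.sgcLightPairPair_decAt_of_capacity`** — PP's conclusion `DECAt y j′ (M₁+M₂) P` at a layer from the ONE-LOW CAPACITY inequality
  `y(1−q) ≤ (1−y)·P_G + y·Σ_{1 ≤ k ≤ j′} P(k)(1 − g k)/g k` for any valid zero-pair gates `g` (`decAt_of_zeroCapacity`); with
  `gate_lconv_TP_TP_apply` this makes cell PP a finite family of explicit real inequalities in `(q, y, γᵢ, loᵢ, hiᵢ)` — the exact census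
  (typer g31) says the capacity inequality is also NECESSARY in every instance (315 005 / 315 005), so nothing is lost.
* `LawDec.sgcLightPairPair_below` — the regime `j′ < lo₁ + lo₂` (all charged positive atoms giants): the inequality is `y ≤ q`, from
  top-affordability.  Unconditional.
REMAINING REGIMES for the arms (worst layer class in the census: `j′ ≥ max(lo₁+hi₂, hi₁+lo₂)` in 82 % of instances; tight cases with one
factor's hypothesis slack, e.g. `q = 2/3, y = 1/2, {1,4; 2/3} ⊗ {6,9; 1/4}` at `j′ = 12`): choose `g k = max(t/k, y² + (1−y)t/k)` for the mids
`t < k ≤ j′` (`validAt_creditPair`) and prove the capacity inequality from the two pairs' own capacity inequalities (their DEC data, made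
explicit the same way) — pure real algebra.  HONEST STATUS: PP / PT / TT / L2 / L3 / CW / SGC / `GateMove` / `FarTreeRow` OPEN; RATE class
log\* / honest sentence unchanged.

[this work] (this lane).  The gluing rows served [cite: KozmaNitzan2024, Conjecture 3 (p. 15)]; product measure [cite: Grimmett1999, §1.3 p. 10].
-/

noncomputable section

namespace Summit.CriticalPhenomena.PercolationContinuityZ3.Theorems

namespace Quant

open Finset

/-- two-point law notation `TP[lo, hi, g, h] = g·[h = hi] + (1 − g)·[h = lo]` (as in the lane's other files). -/
local notation3 "TP[" lo ", " hi ", " g ", " h "]" =>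
  (g : ℝ) * (if (h : ℕ) = (hi : ℕ) then (1 : ℝ) else 0) + (1 - (g : ℝ)) * (if (h : ℕ) = (lo : ℕ) then (1 : ℝ) else 0)

namespace LawDec

/-! ### Cell PP reduced to real algebra: the explicit law, its self-sufficiency, and DEC from the capacity inequality -/

/-- a shifted two-point indicator: `[s ≤ h]·{lo, hi; γ}(h − s) = {lo + s, hi + s; γ}(h)`. [folklore] -/
theorem shift_TP_apply (γ : ℝ) (s lo hi h : ℕ) :
    (if s ≤ h then TP[lo, hi, γ, h - s] else 0) = TP[lo + s, hi + s, γ, h] := by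
  by_cases hs : s ≤ h
  · rw [if_pos hs]
    have e1 : (h - s = hi) ↔ (h = hi + s) := by omega
    have e2 : (h - s = lo) ↔ (h = lo + s) := by omega
    simp only [e1, e2]
  · rw [if_neg hs, if_neg (by omega), if_neg (by omega)]; ring

/-- **THE FIVE ATOMS OF `gate_q({lo₁, hi₁; γ₁} ∗ {lo₂, hi₂; γ₂})`**: the gate zero `1 − q` and the masses `q(1−γ₁)(1−γ₂)`, `q(1−γ₁)γ₂`,
`qγ₁(1−γ₂)`, `qγ₁γ₂` at `lo₁+lo₂`, `lo₁+hi₂`, `hi₁+lo₂`, `hi₁+hi₂` (atoms may coincide; `loᵢ ≤ hiᵢ ≤ Mᵢ`). [this work] -/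
theorem gate_lconv_TP_TP_apply (q γ₁ γ₂ : ℝ) (M₁ M₂ lo₁ hi₁ lo₂ hi₂ : ℕ) (hlo₁ : lo₁ ≤ hi₁) (hhi₁ : hi₁ ≤ M₁) (hlo₂ : lo₂ ≤ hi₂)
    (hhi₂ : hi₂ ≤ M₂) (h : ℕ) :
    gate (lconv M₁ M₂ (fun k => TP[lo₁, hi₁, γ₁, k]) (fun k => TP[lo₂, hi₂, γ₂, k])) q h =
      (1 - q) * (if h = 0 then (1 : ℝ) else 0) + q * ((1 - γ₂) * TP[lo₁ + lo₂, hi₁ + lo₂, γ₁, h] + γ₂ * TP[lo₁ + hi₂, hi₁ + hi₂, γ₁, h]) := by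
  have h1M : ∀ k, M₁ < k → TP[lo₁, hi₁, γ₁, k] = 0 := fun k hk => by
    rw [if_neg (by omega), if_neg (by omega)]; ring
  rw [gate_apply, lconv_TP M₁ M₂ lo₂ hi₂ (fun k => TP[lo₁, hi₁, γ₁, k]) γ₂ h1M (hlo₂.trans hhi₂) hhi₂ h,
    shift_TP_apply γ₁ lo₂ lo₁ hi₁ h, shift_TP_apply γ₁ hi₂ lo₁ hi₁ h]
  ring

/-- law facts of `gate_q({lo₁, hi₁; γ₁} ∗ {lo₂, hi₂; γ₂})` on `{0..M₁+M₂}`: nonnegative, vanishing above the top, mass `1`, mean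
`q·(T₁ + T₂)` with `Tᵢ = loᵢ + (hiᵢ − loᵢ)γᵢ`. [this work] -/
theorem gate_lconv_TP_TP_laws (q γ₁ γ₂ : ℝ) (M₁ M₂ lo₁ hi₁ lo₂ hi₂ : ℕ) (hq0 : 0 ≤ q) (hq1 : q ≤ 1)
    (hlo₁ : lo₁ ≤ hi₁) (hhi₁ : hi₁ ≤ M₁) (hγ₁0 : 0 ≤ γ₁) (hγ₁1 : γ₁ ≤ 1)
    (hlo₂ : lo₂ ≤ hi₂) (hhi₂ : hi₂ ≤ M₂) (hγ₂0 : 0 ≤ γ₂) (hγ₂1 : γ₂ ≤ 1) :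
    (∀ h, 0 ≤ gate (lconv M₁ M₂ (fun k => TP[lo₁, hi₁, γ₁, k]) (fun k => TP[lo₂, hi₂, γ₂, k])) q h) ∧
    (∀ h, M₁ + M₂ < h → gate (lconv M₁ M₂ (fun k => TP[lo₁, hi₁, γ₁, k]) (fun k => TP[lo₂, hi₂, γ₂, k])) q h = 0) ∧
    (∑ h ∈ Finset.range (M₁ + M₂ + 1), gate (lconv M₁ M₂ (fun k => TP[lo₁, hi₁, γ₁, k]) (fun k => TP[lo₂, hi₂, γ₂, k])) q h = 1) ∧
    (∑ h ∈ Finset.range (M₁ + M₂ + 1), (h : ℝ) * gate (lconv M₁ M₂ (fun k => TP[lo₁, hi₁, γ₁, k]) (fun k => TP[lo₂, hi₂, γ₂, k])) q h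
      = q * (((lo₁ : ℝ) + ((hi₁ : ℝ) - lo₁) * γ₁) + ((lo₂ : ℝ) + ((hi₂ : ℝ) - lo₂) * γ₂))) := by
  obtain ⟨h10, h1M, h11, h1mean⟩ := twoPointMix_laws (ι := Unit) M₁ ((lo₁ : ℝ) + ((hi₁ : ℝ) - lo₁) * γ₁) (fun _ => (1 : ℝ))
    (fun _ => γ₁) (fun _ => lo₁) (fun _ => hi₁) (fun _ => zero_le_one) (by simp) (fun _ => ⟨hγ₁0, hγ₁1⟩) (fun _ => hlo₁)
    (fun _ => hhi₁) (fun _ _ => rfl)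
  obtain ⟨h20, h2M, h21, h2mean⟩ := twoPointMix_laws (ι := Unit) M₂ ((lo₂ : ℝ) + ((hi₂ : ℝ) - lo₂) * γ₂) (fun _ => (1 : ℝ))
    (fun _ => γ₂) (fun _ => lo₂) (fun _ => hi₂) (fun _ => zero_le_one) (by simp) (fun _ => ⟨hγ₂0, hγ₂1⟩) (fun _ => hlo₂)
    (fun _ => hhi₂) (fun _ _ => rfl)
  simp only [Finset.univ_unique, Finset.sum_singleton, one_mul] at h10 h1M h11 h1mean h20 h2M h21 h2mean
  obtain ⟨n0, nM, n1⟩ := gate_laws (M₁ + M₂) (lconv M₁ M₂ (fun k => TP[lo₁, hi₁, γ₁, k]) (fun k => TP[lo₂, hi₂, γ₂, k])) q hq0 hq1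
    (lconv_nonneg M₁ M₂ _ _ h10 h20) (fun k hk => lconv_eq_zero M₁ M₂ _ _ k hk) (sum_lconv M₁ M₂ _ _ h11 h21)
  refine ⟨n0, nM, n1, ?_⟩
  rw [sum_mul_gate, sum_mul_lconv M₁ M₂ _ _ h11 h21, h1mean, h2mean]

/-- **EVERY CHARGED POSITIVE ATOM OF CELL PP'S LAW IS SELF-SUFFICIENT.**  Under PP's hypotheses on the two light pairs (each admissible:
`loᵢ < hiᵢ ≤ Mᵢ`, `0 ≤ γᵢ ≤ 1`, `q·γᵢ < y ≤ 1`, gated version DEC at every layer below `Mᵢ`), every charged atom `k > 0` of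
`gate_q({lo₁, hi₁; γ₁} ∗ {lo₂, hi₂; γ₂})` satisfies `q(T₁ + T₂) ≤ 2k` (it is one of the four sums `≥ lo₁ + lo₂`, and `q·Tᵢ ≤ 2loᵢ` by
`lightPair_two_lo_ge`).  So the gate zero is the only low atom at every layer. [this work] -/
theorem sgcLightPairPair_selfSufficient (y q γ₁ γ₂ : ℝ) (M₁ M₂ lo₁ hi₁ lo₂ hi₂ : ℕ) (hy1 : y ≤ 1)
    (hlohi₁ : lo₁ < hi₁) (hhi₁ : hi₁ ≤ M₁) (hγ₁0 : 0 ≤ γ₁) (hγ₁1 : γ₁ ≤ 1) (hlight₁ : q * γ₁ < y)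
    (hD₁ : ∀ j', j' < M₁ → DECAt y j' M₁ (gate (fun h => TP[lo₁, hi₁, γ₁, h]) q))
    (hlohi₂ : lo₂ < hi₂) (hhi₂ : hi₂ ≤ M₂) (hγ₂0 : 0 ≤ γ₂) (hγ₂1 : γ₂ ≤ 1) (hlight₂ : q * γ₂ < y)
    (hD₂ : ∀ j', j' < M₂ → DECAt y j' M₂ (gate (fun h => TP[lo₂, hi₂, γ₂, h]) q))
    (k : ℕ) (hk : 0 < k) (hcharged : 0 < gate (lconv M₁ M₂ (fun h => TP[lo₁, hi₁, γ₁, h]) (fun h => TP[lo₂, hi₂, γ₂, h])) q k) :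
    q * (((lo₁ : ℝ) + ((hi₁ : ℝ) - lo₁) * γ₁) + ((lo₂ : ℝ) + ((hi₂ : ℝ) - lo₂) * γ₂)) ≤ 2 * (k : ℝ) := by
  have h1 := lightPair_two_lo_ge y q γ₁ M₁ lo₁ hi₁ hy1 hlohi₁ hhi₁ hγ₁0 hγ₁1 hlight₁ hD₁
  have h2 := lightPair_two_lo_ge y q γ₂ M₂ lo₂ hi₂ hy1 hlohi₂ hhi₂ hγ₂0 hγ₂1 hlight₂ hD₂
  -- a charged positive atom is one of the four sums, all `≥ lo₁ + lo₂`
  have hge : lo₁ + lo₂ ≤ k := by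
    by_contra hlt
    rw [not_le] at hlt
    rw [gate_lconv_TP_TP_apply q γ₁ γ₂ M₁ M₂ lo₁ hi₁ lo₂ hi₂ hlohi₁.le hhi₁ hlohi₂.le hhi₂ k, if_neg (by omega),
      if_neg (show k ≠ hi₁ + lo₂ by omega), if_neg (show k ≠ lo₁ + lo₂ by omega), if_neg (show k ≠ hi₁ + hi₂ by omega),
      if_neg (show k ≠ lo₁ + hi₂ by omega)] at hcharged
    simp at hcharged
  have : ((lo₁ + lo₂ : ℕ) : ℝ) ≤ k := by exact_mod_cast hge
  push_cast at this
  linarith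

/-- **CELL PP FROM THE CAPACITY INEQUALITY, LAYER BY LAYER.**  Under PP's hypotheses on the two light pairs (admissible, top-affordable —
so `loᵢ ≥ 1`, `lightPair_lo_pos`), at a layer `j′ < M₁ + M₂`:
given gates `0 < g k ≤ 1` making the zero pairs `{0, k; g k}` valid at `(y, q(T₁+T₂), j′)` for the charged mids `k ≤ j′` with `g k < 1`,
the capacity inequality `y·(1 − q) ≤ (1−y)·P_G + y·Σ_{1 ≤ k ≤ j′} P(k)(1 − g k)/g k` for `P = gate_q({lo₁, hi₁; γ₁} ∗ {lo₂, hi₂; γ₂})`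
gives `DECAt y j′ (M₁ + M₂) P` — PP's conclusion at that layer (`decAt_of_zeroCapacity` + `sgcLightPairPair_selfSufficient`).  With
`gate_lconv_TP_TP_apply` every quantity here is an explicit rational function of `(q, y, γᵢ, loᵢ, hiᵢ)`. [this work] -/
theorem sgcLightPairPair_decAt_of_capacity (y q γ₁ γ₂ : ℝ) (M₁ M₂ lo₁ hi₁ lo₂ hi₂ j' : ℕ) (g : ℕ → ℝ)
    (hy0 : 0 < y) (hy1 : y < 1) (hq0 : 0 < q) (hq1 : q ≤ 1)
    (hlohi₁ : lo₁ < hi₁) (hhi₁ : hi₁ ≤ M₁) (hγ₁0 : 0 ≤ γ₁) (hγ₁1 : γ₁ ≤ 1) (hlight₁ : q * γ₁ < y)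
    (hD₁ : ∀ j', j' < M₁ → DECAt y j' M₁ (gate (fun h => TP[lo₁, hi₁, γ₁, h]) q))
    (hlohi₂ : lo₂ < hi₂) (hhi₂ : hi₂ ≤ M₂) (hγ₂0 : 0 ≤ γ₂) (hγ₂1 : γ₂ ≤ 1) (hlight₂ : q * γ₂ < y)
    (hD₂ : ∀ j', j' < M₂ → DECAt y j' M₂ (gate (fun h => TP[lo₂, hi₂, γ₂, h]) q))
    (hta₁ : y * (M₁ : ℝ) ≤ q * ((lo₁ : ℝ) + ((hi₁ : ℝ) - lo₁) * γ₁)) (hta₂ : y * (M₂ : ℝ) ≤ q * ((lo₂ : ℝ) + ((hi₂ : ℝ) - lo₂) * γ₂))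
    (hj : j' < M₁ + M₂) (hg : ∀ k, 0 < g k ∧ g k ≤ 1)
    (hvalid : ∀ k, 0 < k → k ≤ j' → 0 < gate (lconv M₁ M₂ (fun h => TP[lo₁, hi₁, γ₁, h]) (fun h => TP[lo₂, hi₂, γ₂, h])) q k →
      g k < 1 → ValidAt y (q * (((lo₁ : ℝ) + ((hi₁ : ℝ) - lo₁) * γ₁) + ((lo₂ : ℝ) + ((hi₂ : ℝ) - lo₂) * γ₂))) j' 0 k (g k))
    (hcap : y * (1 - q) ≤ (1 - y) * ∑ h ∈ Finset.Ico (j' + 1) (M₁ + M₂ + 1),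
        gate (lconv M₁ M₂ (fun h => TP[lo₁, hi₁, γ₁, h]) (fun h => TP[lo₂, hi₂, γ₂, h])) q h
      + y * ∑ k ∈ Finset.Ico 1 (j' + 1),
        gate (lconv M₁ M₂ (fun h => TP[lo₁, hi₁, γ₁, h]) (fun h => TP[lo₂, hi₂, γ₂, h])) q k * (1 - g k) / g k) :
    DECAt y j' (M₁ + M₂) (gate (lconv M₁ M₂ (fun h => TP[lo₁, hi₁, γ₁, h]) (fun h => TP[lo₂, hi₂, γ₂, h])) q) := by
  obtain ⟨n0, nM, n1, nmean⟩ := gate_lconv_TP_TP_laws q γ₁ γ₂ M₁ M₂ lo₁ hi₁ lo₂ hi₂ hq0.le hq1 hlohi₁.le hhi₁ hγ₁0 hγ₁1 hlohi₂.le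
    hhi₂ hγ₂0 hγ₂1
  have hl₁ := lightPair_lo_pos y q γ₁ M₁ lo₁ hi₁ hy0 hlohi₁ hhi₁ hlight₁ hta₁
  have hl₂ := lightPair_lo_pos y q γ₂ M₂ lo₂ hi₂ hy0 hlohi₂ hhi₂ hlight₂ hta₂
  have hzero : gate (lconv M₁ M₂ (fun h => TP[lo₁, hi₁, γ₁, h]) (fun h => TP[lo₂, hi₂, γ₂, h])) q 0 = 1 - q := by
    rw [gate_lconv_TP_TP_apply q γ₁ γ₂ M₁ M₂ lo₁ hi₁ lo₂ hi₂ hlohi₁.le hhi₁ hlohi₂.le hhi₂ 0, if_pos rfl,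
      if_neg (show (0 : ℕ) ≠ hi₁ + lo₂ by omega), if_neg (show (0 : ℕ) ≠ lo₁ + lo₂ by omega),
      if_neg (show (0 : ℕ) ≠ hi₁ + hi₂ by omega), if_neg (show (0 : ℕ) ≠ lo₁ + hi₂ by omega)]
    ring
  refine decAt_of_zeroCapacity y j' (M₁ + M₂) _ g hj n0 nM n1 hy0 hy1 (fun k hk hkj hch => ?_) hg (fun k hk hkj hch hgk => ?_) ?_
  · rw [nmean]
    exact sgcLightPairPair_selfSufficient y q γ₁ γ₂ M₁ M₂ lo₁ hi₁ lo₂ hi₂ hy1.le hlohi₁ hhi₁ hγ₁0 hγ₁1 hlight₁ hD₁ hlohi₂ hhi₂ hγ₂0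
      hγ₂1 hlight₂ hD₂ k hk hch
  · rw [nmean]; exact hvalid k hk hkj hch hgk
  · rw [hzero]; exact hcap

/-- **CELL PP AT THE LAYERS BELOW `lo₁ + lo₂`** (every charged positive atom a giant): the giants carry mass `q`, and the capacity
inequality `y(1−q) ≤ (1−y)q` is `y ≤ q`, which top-affordability of either pair gives (`y·hi₂ ≤ y·M₂ ≤ q·T₂ ≤ q·hi₂`).  The first
(unconditional) regime of PP. [this work] -/
theorem sgcLightPairPair_below (y q γ₁ γ₂ : ℝ) (M₁ M₂ lo₁ hi₁ lo₂ hi₂ j' : ℕ)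
    (hy0 : 0 < y) (hy1 : y < 1) (hq0 : 0 < q) (hq1 : q ≤ 1)
    (hlohi₁ : lo₁ < hi₁) (hhi₁ : hi₁ ≤ M₁) (hγ₁0 : 0 ≤ γ₁) (hγ₁1 : γ₁ ≤ 1) (hlight₁ : q * γ₁ < y)
    (hD₁ : ∀ j', j' < M₁ → DECAt y j' M₁ (gate (fun h => TP[lo₁, hi₁, γ₁, h]) q))
    (hta₁ : y * (M₁ : ℝ) ≤ q * ((lo₁ : ℝ) + ((hi₁ : ℝ) - lo₁) * γ₁))
    (hlohi₂ : lo₂ < hi₂) (hhi₂ : hi₂ ≤ M₂) (hγ₂0 : 0 ≤ γ₂) (hγ₂1 : γ₂ ≤ 1) (hlight₂ : q * γ₂ < y)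
    (hta₂ : y * (M₂ : ℝ) ≤ q * ((lo₂ : ℝ) + ((hi₂ : ℝ) - lo₂) * γ₂))
    (hD₂ : ∀ j', j' < M₂ → DECAt y j' M₂ (gate (fun h => TP[lo₂, hi₂, γ₂, h]) q))
    (hj : j' < lo₁ + lo₂) :
    DECAt y j' (M₁ + M₂) (gate (lconv M₁ M₂ (fun h => TP[lo₁, hi₁, γ₁, h]) (fun h => TP[lo₂, hi₂, γ₂, h])) q) := by
  set P : ℕ → ℝ := gate (lconv M₁ M₂ (fun h => TP[lo₁, hi₁, γ₁, h]) (fun h => TP[lo₂, hi₂, γ₂, h])) q with hP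
  obtain ⟨n0, nM, n1, -⟩ := gate_lconv_TP_TP_laws q γ₁ γ₂ M₁ M₂ lo₁ hi₁ lo₂ hi₂ hq0.le hq1 hlohi₁.le hhi₁ hγ₁0 hγ₁1 hlohi₂.le
    hhi₂ hγ₂0 hγ₂1
  -- `y ≤ q` from top-affordability of the second pair
  have hyq : y ≤ q := by
    have hT2 : (lo₂ : ℝ) + ((hi₂ : ℝ) - lo₂) * γ₂ ≤ hi₂ := by
      have : (lo₂ : ℝ) ≤ hi₂ := by exact_mod_cast hlohi₂.le
      nlinarith
    have hM : (hi₂ : ℝ) ≤ M₂ := by exact_mod_cast hhi₂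
    have hhi0 : (0 : ℝ) < hi₂ := by exact_mod_cast (lt_of_le_of_lt (Nat.zero_le lo₂) hlohi₂)
    have h1 : y * (hi₂ : ℝ) ≤ q * (hi₂ : ℝ) := by nlinarith [mul_le_mul_of_nonneg_left hT2 hq0.le]
    exact le_of_mul_le_mul_right h1 hhi0
  -- below `lo₁ + lo₂` the only charged atom is `0`, so the giants carry `q`
  have hbelow : ∀ k, 0 < k → k ≤ j' → P k = 0 := by
    intro k hk hkj
    rw [hP, gate_lconv_TP_TP_apply q γ₁ γ₂ M₁ M₂ lo₁ hi₁ lo₂ hi₂ hlohi₁.le hhi₁ hlohi₂.le hhi₂ k, if_neg (by omega),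
      if_neg (show k ≠ hi₁ + lo₂ by omega), if_neg (show k ≠ lo₁ + lo₂ by omega), if_neg (show k ≠ hi₁ + hi₂ by omega),
      if_neg (show k ≠ lo₁ + hi₂ by omega)]
    ring
  have hPG : ∑ h ∈ Finset.Ico (j' + 1) (M₁ + M₂ + 1), P h = q := by
    have hsplit := Finset.sum_range_add_sum_Ico P (show j' + 1 ≤ M₁ + M₂ + 1 by omega)
    have hlowsum : ∑ h ∈ Finset.range (j' + 1), P h = 1 - q := by
      rw [Finset.sum_eq_single 0]
      · rw [hP, gate_lconv_TP_TP_apply q γ₁ γ₂ M₁ M₂ lo₁ hi₁ lo₂ hi₂ hlohi₁.le hhi₁ hlohi₂.le hhi₂ 0, if_pos rfl,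
          if_neg (show (0 : ℕ) ≠ hi₁ + lo₂ by omega), if_neg (show (0 : ℕ) ≠ lo₁ + lo₂ by omega),
          if_neg (show (0 : ℕ) ≠ hi₁ + hi₂ by omega), if_neg (show (0 : ℕ) ≠ lo₁ + hi₂ by omega)]
        ring
      · intro k hk hk0
        exact hbelow k (Nat.pos_of_ne_zero hk0) (Nat.lt_succ_iff.1 (Finset.mem_range.1 hk))
      · intro hn; exact absurd (Finset.mem_range.2 (Nat.succ_pos j')) hn
    rw [n1, hlowsum] at hsplit
    linarith
  refine sgcLightPairPair_decAt_of_capacity y q γ₁ γ₂ M₁ M₂ lo₁ hi₁ lo₂ hi₂ j' (fun _ => 1) hy0 hy1 hq0 hq1 hlohi₁ hhi₁ hγ₁0 hγ₁1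
    hlight₁ hD₁ hlohi₂ hhi₂ hγ₂0 hγ₂1 hlight₂ hD₂ hta₁ hta₂ (by omega) (fun _ => ⟨zero_lt_one, le_rfl⟩)
    (fun k _ _ _ h1 => absurd h1 (lt_irrefl _)) ?_
  have hmid : ∑ k ∈ Finset.Ico 1 (j' + 1), P k * (1 - (1 : ℝ)) / 1 = 0 :=
    Finset.sum_eq_zero fun k _ => by ring
  rw [hPG, hmid, mul_zero, add_zero]
  nlinarith

end LawDec

end Quant

end Summit.CriticalPhenomena.PercolationContinuityZ3.Theorems
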